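import Summits.BirchSwinnertonDyer.BirchSwinnertonDyer.Theorems.PrintCFramBottomClassIndexLawFiveLeFlipRungTwoOddCutCohen
import Summits.BirchSwinnertonDyer.BirchSwinnertonDyer.Theorems.PrintCFramBottomClassIndexLawFiveLeFlipRungTwoClassProjLevel
import Summits.BirchSwinnertonDyer.BirchSwinnertonDyer.Theorems.PrintCFramBottomClassIndexLawFiveLeFlipRungTwoVehicle
import Summits.BirchSwinnertonDyer.BirchSwinnertonDyer.Theorems.PrintCFramBottomClassIndexLawFiveLeFlipRungTwoBracketMain
import Summits.BirchSwinnertonDyer.BirchSwinnertonDyer.Theorems.PrintCFramBottomClassIndexLawFiveLeFlipRungTwoFlipWeightUnit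
import Summits.BirchSwinnertonDyer.BirchSwinnertonDyer.Theorems.PrintCFramBottomClassIndexLawFiveLeFlipRungTwoBracket
import HarnessLib

/-!
# Crux `PrintCFram.BottomClassIndexLawFiveLe` (stmt-BirchSwinnertonDyer-20372), line `eisenstein-resource-bdp-line` (registry v29/v30a `stub_flipRungTwo`):
# THE 2-ADIC FLIPPED-CUSP RUNG — THE MODULAR ASSEMBLY `jmlTwo_six_of_facts : NF-A → NF-Q → (JMLTwo⁶)`
# (cell `bsd-print-cfram`, width seat `bsd-line-cfram-p1-w7` g9; THEOREMS ONLY, `--supports` 20372 `--as helper`; BSD is not proved by any of this)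

HONEST FRAMING. Nothing here is a statement about BSD or elliptic curves; no registered stub is closed by this file ALONE: it discharges the
modular-object-free interface (JMLTwo⁶) of seat w6 g10 (`…FlipRungTwoOfJML.rungTwoFour_six_of_jmlTwo`, its `hJML` binder VERBATIM) from the two
named facts NF-A (Cohen 1975 Thm 3.1, `thm31_cohenSeries_mem_halfIntModularForms`) and NF-Q (Katz 1973 Cor. 1.6.2, `Katz1973_qExpansionPrinciple_allCusps`).
With w6 g10's `flipRungTwo_six_of_jmlTwo_of_eight` the registered `stub_flipRungTwo` = (FlipRungTwo⁶) then reduces to the `8 ∣ m` residue (P6, seats w6 g10 /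
w8 g10). THE CHAIN (crux notes `Lines/eisenstein-resource-bdp-line-w7g8-T6.md` §5, all pieces in the tree):
`G` = the AWAY₂ cut of `H_k` in `M_{(2k+1)/2}(4Q₀², 1)`, `Q₀ = 3(m/4)²` ((M1)/(M1b), this seat) ⟶ `g = G|U_4` (`heckeFun`, coefficients `a(4n)`) ⟶
`P = P_c g ∈ M_{(2k+1)/2}(256Q₀², 1)` ((A0)) ⟶ Katz vehicle `f = P·θ ∈ ModularForm (Γ₁(256Q₀²)) (k+1)`, `≡ 0 (mod p)` at `∞` under the class
hypothesis ((A1)) ⟶ NF-Q at the flipped cusp `γ₀ = [[a,b],[Q₀², 64]]`: every coefficient of the bracket `B` lies in `p·ℤ̄[1/N]`, `N = 256Q₀²` (w5 g8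
P4a–d `exists_isIntegral_bracket_coeff`) ⟶ `c_B(n·N/64) = 8^{−(k+1)}·W_c(n)·a(4n)` for `4 ∤ n` ((A2), from w7 g8's P1/P3 and w5 g8's `coeff_eq_of_periodic_junk`)
⟶ `W_c(n)` is a unit on the live classes `n + c ≡ 2k+1 (mod 4)` ((A2b), from w7 g8's P1b/T6a) ⟶ `a(4n) ∈ p·ℤ̄[1/N]`.

* §1 arithmetic of the datum (`m = 4m₁`, `m₁` odd, `p ∤ 256·Q₀⁴`), the cusp matrix `exists_cuspMatrix_sixtyfour`, `ℤ̄`-closure helpers;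
* §2 **`jmlTwo_six_of_facts`**.

No definitions, no named facts, no `sorry`. beyond-print theorem: NO (assembly of Shimura 1973 §1 / Katz 1973 Cor. 1.6.2 bookkeeping).
References: [Shimura1973HalfIntegral] §1, Prop. 1.5, Thm. 1.7; [Cohen1975] Thm. 3.1; [Katz1973] §1.6 Cor. 1.6.2 (both named facts, hypotheses).
-/

set_option autoImplicit false
-- summit-side namespace `Summit.BirchSwinnertonDyer.BirchSwinnertonDyer.…` (single-conjunct summit, D-0017 layout)
set_option linter.dupNamespace false

noncomputable section

open UpperHalfPlane hiding I
open Complex CongruenceSubgroup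
open scoped MatrixGroups NumberTheorySymbols Real Classical
open Literature.NumberTheory.EllipticCurves.ModularForms
open Literature.NumberTheory.EllipticCurves.Tunnell1983 (zeta8 classProj classProj_apply)
open Literature.NumberTheory.ModularForms.CohenEisenstein

namespace Summit.BirchSwinnertonDyer.BirchSwinnertonDyer.Theorems.PrintCFram.FlipRung

/-! ## §1 Arithmetic of the datum and the cusp matrix -/

/-- `2 ∣ m`, `4 ∣ m`, `8 ∤ m` ⟹ `m/4` is odd and positive. [folklore] -/
theorem odd_div_four_of_not_eight_dvd {m : ℕ} (hm0 : 0 < m) (h4 : 4 ∣ m) (h8 : ¬ 8 ∣ m) : Odd (m / 4) ∧ 0 < m / 4 := by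
  obtain ⟨m₁, rfl⟩ := h4
  rw [Nat.mul_div_cancel_left _ (by norm_num : 0 < 4)]
  refine ⟨?_, by omega⟩
  by_contra h
  rw [Nat.not_odd_iff_even] at h
  obtain ⟨r, hr⟩ := h
  exact h8 ⟨r, by omega⟩

/-- For the six primes of the line and `m ⊥ p`: `p ∤ 256·(3(m/4)²)²`. [folklore] -/
theorem not_dvd_level {p m : ℕ} (hp : p.Prime) (hp6 : p = 7 ∨ p = 11 ∨ p = 19 ∨ p = 43 ∨ p = 67 ∨ p = 163) (hmp : m.Coprime p)
    (h4 : 4 ∣ m) : ¬ p ∣ 256 * (3 * (m / 4) ^ 2) ^ 2 := by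
  have hp2 : ¬ p ∣ 2 := fun h ↦ by have := (Nat.prime_dvd_prime_iff_eq hp Nat.prime_two).mp h; omega
  have hp3 : ¬ p ∣ 3 := fun h ↦ by have := (Nat.prime_dvd_prime_iff_eq hp Nat.prime_three).mp h; omega
  have hpm4 : ¬ p ∣ m / 4 := by
    intro h
    have hpm : p ∣ m := h.trans (Nat.div_dvd_of_dvd h4)
    exact hp.one_lt.ne' (Nat.Coprime.eq_one_of_dvd hmp.symm hpm)
  intro h
  rcases (Nat.Prime.dvd_mul hp).mp h with h | h
  · exact hp2 (hp.dvd_of_dvd_pow (by simpa using h : p ∣ 2 ^ 8))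
  · have h' := hp.dvd_of_dvd_pow h
    rcases (Nat.Prime.dvd_mul hp).mp h' with h'' | h''
    · exact hp3 h''
    · exact hpm4 (hp.dvd_of_dvd_pow h'')

/-- **The cusp matrix of the 2-adic rung.** For odd `M` there are `a ≥ 0`, `b` with `64a − Mb = 1`, i.e. `γ₀ = [[a,b],[M,64]] ∈ SL₂(ℤ)`
(the cusp `a/M`; `gcd(M, 64) = 1`, and `a` is normalised non-negative by `(a, b) ↦ (a + tM, b + 64t)`). [folklore] -/
theorem exists_cuspMatrix_sixtyfour {M : ℕ} (hM : Odd M) :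
    ∃ (γ₀ : SL(2, ℤ)) (a b : ℤ), 0 ≤ a ∧ 64 * a - (M : ℤ) * b = 1 ∧
      (γ₀ 0 0 : ℤ) = a ∧ (γ₀ 0 1 : ℤ) = b ∧ (γ₀ 1 0 : ℤ) = M ∧ (γ₀ 1 1 : ℤ) = 64 := by
  have hcop : IsCoprime (64 : ℤ) (M : ℤ) := by
    rw [Int.isCoprime_iff_gcd_eq_one]
    have h2 : Nat.Coprime 2 M := (Nat.Prime.coprime_iff_not_dvd Nat.prime_two).mpr (by
      intro h; exact (Nat.not_even_iff_odd.mpr hM) (even_iff_two_dvd.mpr h))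
    have : Nat.Coprime 64 M := by
      rw [show (64 : ℕ) = 2 ^ 6 by norm_num]; exact Nat.Coprime.pow_left 6 h2
    simpa [Int.gcd] using this
  obtain ⟨u, v, huv⟩ := hcop
  obtain ⟨t, ht⟩ : ∃ t : ℤ, 0 ≤ u + t * M := by
    rcases hM with ⟨m, hm⟩
    refine ⟨|u|, ?_⟩
    have hM1 : (1 : ℤ) ≤ M := by omega
    nlinarith [abs_nonneg u, neg_abs_le u, abs_mul_self u]
  refine ⟨⟨!![u + t * M, -(v - 64 * t); (M : ℤ), 64], ?_⟩, u + t * M, -(v - 64 * t), ht, ?_, rfl, rfl, rfl, rfl⟩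
  · rw [Matrix.det_fin_two_of]; linear_combination huv
  · linear_combination huv

/-- `ℤ̄ ⊆ ℤ̄[1/N]` for products: `N^j·y` integral and `v` integral ⟹ `N^j·(x·y·v)` integral for an integer-cast `x`. [folklore] -/
theorem exists_isIntegral_pow_mul_mul_mul {N : ℕ} {y v : ℂ} (x : ℕ) (hy : ∃ j : ℕ, IsIntegral ℤ ((N : ℂ) ^ j * y))
    (hv : IsIntegral ℤ v) : ∃ j : ℕ, IsIntegral ℤ ((N : ℂ) ^ j * ((x : ℂ) * y * v)) := by
  obtain ⟨j, hj⟩ := hy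
  refine ⟨j, ?_⟩
  have : (N : ℂ) ^ j * ((x : ℂ) * y * v) = (x : ℂ) * ((N : ℂ) ^ j * y) * v := by ring
  rw [this]
  exact ((isIntegral_natCast' x).mul hj).mul hv
where
  /-- natural numbers are integral (helper spelling). [folklore] -/
  isIntegral_natCast' (x : ℕ) : IsIntegral ℤ (x : ℂ) := by exact_mod_cast isIntegral_intCast (x : ℤ)

/-! ## §2 The modular assembly -/

/-- **THE 2-ADIC FLIPPED-CUSP RUNG FROM THE NAMED FACTS: `jmlTwo_six_of_facts : NF-A → NF-Q → (JMLTwo⁶)`.** The conclusion is the `hJML` binder of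
w6 g10's `rungTwoFour_six_of_jmlTwo` VERBATIM: for a class datum of the line with `4 ∥ m`, a sign pattern `τ` at the odd primes of `m`, and the
coefficient function `a = 𝟙_{AWAY₂}·H(k,·)`, there is `N` (`p ∤ N`, `2 ∣ N`; here `N = 256·(3(m/4)²)²`) such that for every class
`c mod 8`: if `a(4n) ∈ p·ℤ̄[1/N]` for all `n ≡ c (8)` then `a(4n) ∈ p·ℤ̄[1/N]` for all `n` with `n + c ≡ 2k+1 (mod 4)`, `4 ∤ n`. CONDITIONAL on NF-A and
NF-Q (hypotheses). [cite: Shimura1973HalfIntegral, §1, Prop. 1.5] [cite: Cohen1975, Thm. 3.1] [cite: Katz1973, §1.6 Cor. 1.6.2] -/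
theorem jmlTwo_six_of_facts (hA : Literature.NumberTheory.ModularForms.Cohen1975.thm31_cohenSeries_mem_halfIntModularForms)
    (hKatz : Literature.NumberTheory.ModularForms.Katz1973_qExpansionPrinciple_allCusps) :
    ∀ (p : ℕ) [Fact p.Prime] (m : ℕ) [NeZero m] (χ : DirichletCharacter ℚ_[p] m) (k : ℕ),
      (p = 7 ∨ p = 11 ∨ p = 19 ∨ p = 43 ∨ p = 67 ∨ p = 163) →
      m.Coprime p → χ.IsPrimitive → χ.IsQuadratic → (k = (p + 1) / 4 ∨ k = (3 * p - 1) / 4) →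
      2 ≤ k → k ≤ p - 2 → χ (-1) * (-1) ^ k = -1 → 2 ∣ m → 4 ∣ m → ¬ 8 ∣ m →
      ∀ (τ : ℕ → ℤ), (∀ q' : ℕ, q'.Prime → q' ∣ m → q' ≠ 2 → (τ q' = 1 ∨ τ q' = -1)) →
      ∀ (a : ℕ → ℚ),
        (∀ i : ℕ, (m / 4 ∣ i ∧
            (∀ q' : ℕ, q'.Prime → q' ∣ m → q' ≠ 2 → jacobiSym (-((i / (m / 4) : ℕ) : ℤ)) q' = τ q') ∧
            ¬ 3 ∣ i / (m / 4)) → a i = cohenH k i) →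
        (∀ i : ℕ, ¬ (m / 4 ∣ i ∧
            (∀ q' : ℕ, q'.Prime → q' ∣ m → q' ≠ 2 → jacobiSym (-((i / (m / 4) : ℕ) : ℤ)) q' = τ q') ∧
            ¬ 3 ∣ i / (m / 4)) → a i = 0) →
      ∃ N : ℕ, ¬ p ∣ N ∧ 2 ∣ N ∧
        ∀ c : ℕ,
          (∀ n : ℕ, n % 8 = c % 8 →
            ∃ y : ℂ, (∃ j : ℕ, IsIntegral ℤ ((N : ℂ) ^ j * y)) ∧ ((a (4 * n) : ℚ) : ℂ) = (p : ℂ) * y) →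
          ∀ n : ℕ, (n + c) % 4 = (2 * k + 1) % 4 → ¬ 4 ∣ n →
            ∃ y : ℂ, (∃ j : ℕ, IsIntegral ℤ ((N : ℂ) ^ j * y)) ∧ ((a (4 * n) : ℚ) : ℂ) = (p : ℂ) * y := by
  intro p _ m _ χ k hp6 hmp _hχ _hχq _hk hk2 _hkp _hpar _h2m h4m h8m τ _hτ a ha hna
  have hpp : p.Prime := Fact.out
  have hm0 : 0 < m := Nat.pos_of_ne_zero (NeZero.ne m)
  obtain ⟨hm₁odd, hm₁0⟩ := odd_div_four_of_not_eight_dvd hm0 h4m h8m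
  have hQ₀odd : Odd (3 * (m / 4) ^ 2) := (by decide : Odd 3).mul hm₁odd.pow
  have hpN' := not_dvd_level hpp hp6 hmp h4m
  -- (M1b): the cut `G` of `H_k`; then make the odd level `M = (3(m/4)²)²` opaque
  obtain ⟨G, hG, hGq⟩ := exists_awayTwoCut_cohen hA hk2 m τ h4m hm₁0
  generalize hMdef : (3 * (m / 4) ^ 2) ^ 2 = M at hG hpN'
  have hModd : Odd M := by rw [← hMdef]; exact hQ₀odd.pow
  have hM0 : 0 < M := hModd.pos
  haveI : NeZero M := ⟨hM0.ne'⟩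
  have h4N : 4 ∣ 4 * M := dvd_mul_right 4 M
  have hL4 : 4 ∣ 4 * M * 8 ^ 2 := h4N.mul_right _
  haveI : NeZero (4 * M * 8 ^ 2) := ⟨by positivity⟩
  -- `g = G|U_4` (opaque): membership, coefficients `a(4n)`, `Γ₀(4M)`-automorphy
  obtain ⟨g, hg, hgq, hgs⟩ : ∃ g : ℍ → ℂ, g ∈ halfIntModularForms (2 * k + 1) (4 * M) (1 : DirichletCharacter ℂ (4 * M)) ∧
      (∀ n : ℕ, qCoeffs g n = qCoeffs G (4 * n)) ∧
      ∀ γ ∈ Gamma0 (4 * M), ∀ z : ℍ, g (γ • z) = autFactor (2 * k + 1) (4 * M) (1 : DirichletCharacter ℂ (4 * M)) γ z * g z :=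
    ⟨_, heckeFun_two_mem_qCoeffs_smul h4N (odd_two_mul_add_one k) hG⟩
  have hb : ∀ n : ℕ, qCoeffs g n = ((a (4 * n) : ℚ) : ℂ) := by
    intro n
    rw [hgq n, hGq (4 * n)]
    split_ifs with hP
    · rw [ha _ hP]
    · rw [hna _ hP]; push_cast; rfl
  -- the integer `N = 256·M`
  refine ⟨256 * M, hpN', ⟨128 * M, by ring⟩, fun c hclass n hlive h4n ↦ ?_⟩
  -- (A0): the class projection `P = P_c g ∈ M_{(2k+1)/2}(256 M, 1)`
  have hP := classProj_mem_halfIntModularForms_one h4N hg c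
  -- (A1): the Katz vehicle `f = P·θ` on `Γ₁(256 M)` and its congruence at `∞`
  have hclass' : ∀ n' : ℕ, n' % 8 = c % 8 →
      ∃ y : ℂ, (∃ j : ℕ, IsIntegral ℤ (((256 * M : ℕ) : ℂ) ^ j * y)) ∧ qCoeffs g n' = (p : ℂ) * y := by
    intro n' hn'
    rw [hb]
    exact hclass n' hn'
  obtain ⟨f, hf, hcoef⟩ := exists_classVehicle_of_class_hypothesis (k := k) hL4 hg c hP hclass'
  -- the cusp matrix and the NF-Q transport (P4d)
  obtain ⟨γ₀, a₀, b₀, ha₀, hdet, h00, h01, h10, h11⟩ := exists_cuspMatrix_sixtyfour hModd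
  have hLN : 4 * M * 8 ^ 2 ∣ 256 * M := ⟨1, by ring⟩
  have hN3 : 3 ≤ 256 * M := by omega
  have h256 : 256 ∣ 256 * M := dvd_mul_right 256 M
  have hMN : M ∣ 256 * M := dvd_mul_left M 256
  have hNP : ((4 * M * 8 ^ 2 : ℕ) : ℤ) ∣ 256 * (M : ℤ) := ⟨1, by push_cast; ring⟩
  have hcB := exists_isIntegral_bracket_coeff hKatz hModd γ₀ h10 h11 hLN hN3 h256 hMN f hf hL4 hP hNP p hcoef
  have hB := (bracket_analytic_and_hasSum hL4 hP γ₀ h10 h11 hModd hNP h256 (by positivity) (k := k)).2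
  -- (A2): the coefficient of the bracket at `n·N/64` is `8^{−(k+1)}·W_c(n)·b(n)`
  have h64 : 64 ∣ 256 * M := ⟨4 * M, by ring⟩
  have key := bracket_coeff_eq_flipWeight_mul ha₀ hdet γ₀ h00 h01 h10 h11 hgs (hasSum_qCoeffs hg) c h64 (by positivity)
    (cB := fun m' : ℕ ↦ (qExpansion ((256 * M : ℕ) : ℝ) (fun z : ℍ ↦ ((8 : ℂ)⁻¹) ^ (k + 1) * (classProj c g (γ₀ • z) *
      (Complex.sqrt (((M : ℂ) * z + 64) / 8) ^ (2 * k + 1))⁻¹))).coeff m')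
    (fun z ↦ by have h := hB z; simp only [smul_eq_mul] at h; exact h) n h4n
  -- (A2b): the flip weight is a unit on the live class
  obtain ⟨v, hvint, hWv⟩ := exists_isIntegral_flipWeight_mul_eq_one hModd k c n hlive
  -- conclusion
  obtain ⟨y, hy, hyeq⟩ := hcB (n * (256 * M / 64))
  refine ⟨((8 ^ (k + 1) : ℕ) : ℂ) * y * v, exists_isIntegral_pow_mul_mul_mul _ hy hvint, ?_⟩
  rw [← hb n]
  -- `b(n) = 8^{k+1}·c_B·v` from `key` and `W·v = 1`
  have h8 : ((8 : ℂ)⁻¹) ^ (k + 1) * ((8 ^ (k + 1) : ℕ) : ℂ) = 1 := by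
    push_cast
    rw [← mul_pow, inv_mul_cancel₀ (by norm_num : (8 : ℂ) ≠ 0), one_pow]
  calc qCoeffs g n
      = qCoeffs g n * (((8 : ℂ)⁻¹) ^ (k + 1) * ((8 ^ (k + 1) : ℕ) : ℂ)) * 1 := by rw [h8]; ring
    _ = ((8 ^ (k + 1) : ℕ) : ℂ) * (((8 : ℂ)⁻¹) ^ (k + 1) * (∑ j ∈ ({1, 3, 5, 7} : Finset ℕ),
          (8 : ℂ)⁻¹ * (zeta8 ^ (c * j))⁻¹ *
            ((1 : DirichletCharacter ℂ (4 * M)) (((8 + (M : ℤ) * (j : ℤ) : ℤ)) : ZMod (4 * M)) *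
              ((thetaEps (8 + (M : ℤ) * (j : ℤ)))⁻¹ * (J(8 * (M : ℤ) | (8 + (M : ℤ) * (j : ℤ)).natAbs) : ℂ)) ^ (2 * k + 1)) *
            cexp (-(2 * π * I * ((j * n : ℕ) : ℂ) / 8))) * qCoeffs g n) * v := by
        rw [← hWv]; ring
    _ = ((8 ^ (k + 1) : ℕ) : ℂ) * ((p : ℂ) * y) * v := by rw [← key, hyeq]
    _ = (p : ℂ) * (((8 ^ (k + 1) : ℕ) : ℂ) * y * v) := by ring

end Summit.BirchSwinnertonDyer.BirchSwinnertonDyer.Theorems.PrintCFram.FlipRung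

end
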